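import Mathlib
import Literature.Probability.Moments.HoeffdingCounting
import Literature.NumberTheory.Sieve.MoebiusWalshCircuitsProofs
import Summits.QuantumAdvantage.QuantumAdvantage.Theorems.MobiusLadderLiouvilleOrthogonalTC0StubCubeTail
import HarnessLib

/-!
# Crux `MobiusLadder.LiouvilleOrthogonalTC0` (stmt-QuantumAdvantage-1393), line `Sketch`, skeleton v8:
stub `stub_sliceTail` (K3b) — few digit strings have atypical Hamming weight

For `t ≥ 0`, `#{N < 2ⁿ : t ≤ |s₂(N) − n/2|} ≤ 2 · 2ⁿ · e^{−2t²/n}`, where `s₂(N)` is the number of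
`1`-digits among the `n` low binary digits of `N` (two-sided Hoeffding bound on the cube
`{0,1}ⁿ`, transported to `{0, …, 2ⁿ − 1}` by binary expansion). Pure counting, no number theory:
the event `t ≤ |w − n/2|` (`w` the weight of a digit vector) is the union of `2t ≤ 2w − n` and
`2t ≤ n − 2w`, and `2w − n`, `n − 2w` are the signed-coordinate sums of `stub_cubeTail` for the
all-`true` and all-`false` orientations, each of which has at most `2ⁿ e^{−(2t)²/(2n)}` points.
-/

set_option linter.dupNamespace false -- D-0017: single-problem summit ⇒ `QuantumAdvantage.QuantumAdvantage` by design

noncomputable section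

namespace Summit.QuantumAdvantage.QuantumAdvantage.Theorems.LiouvilleOrthogonalTC0

open Filter Finset
open Literature.Computability.Complexity (bitsToNat)
open Literature.NumberTheory.Sieve.MoebiusWalsh

/-- Signed-coordinate sum for the all-`true` orientation: `Σ_j (±1) = 2w − n`, `w` the Hamming
weight of the digit vector `x`. -/
theorem sliceTail_sum_sign_true {n : ℕ} (x : Fin n → Bool) :
    ∑ j : Fin n, (if x j = true then (1 : ℝ) else -1)
      = 2 * (((univ : Finset (Fin n)).filter fun i : Fin n => x i = true).card : ℝ) - n := by
  have h1 : ∀ j : Fin n,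
      (if x j = true then (1 : ℝ) else -1) = 2 * (if x j = true then (1 : ℝ) else 0) - 1 := by
    intro j
    split_ifs <;> norm_num
  rw [Finset.sum_congr rfl fun j _ => h1 j, Finset.sum_sub_distrib, ← Finset.mul_sum,
    Finset.sum_boole]
  simp

/-- Signed-coordinate sum for the all-`false` orientation: `Σ_j (±1) = n − 2w`, `w` the Hamming
weight of the digit vector `x`. -/
theorem sliceTail_sum_sign_false {n : ℕ} (x : Fin n → Bool) :
    ∑ j : Fin n, (if x j = false then (1 : ℝ) else -1)
      = n - 2 * (((univ : Finset (Fin n)).filter fun i : Fin n => x i = true).card : ℝ) := by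
  have h1 : ∀ j : Fin n,
      (if x j = false then (1 : ℝ) else -1) = 1 - 2 * (if x j = true then (1 : ℝ) else 0) := by
    intro j
    cases x j <;> norm_num
  rw [Finset.sum_congr rfl fun j _ => h1 j, Finset.sum_sub_distrib, ← Finset.mul_sum,
    Finset.sum_boole]
  simp

/-- Transport of the atypical-weight count from `{0, …, 2ⁿ − 1}` (digits read by `Nat.testBit`)
to the cube `{0,1}ⁿ`, along the binary-expansion bijection `N ↦ (j ↦ N.testBit j)`,
`x ↦ bitsToNat (List.ofFn x)`. -/
theorem sliceTail_card_transport (n : ℕ) (t : ℝ) :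
    ((range (2 ^ n)).filter fun N =>
        t ≤ |((univ.filter fun i : Fin n => Nat.testBit N i = true).card : ℝ) - n / 2|).card
      = ((univ : Finset (Fin n → Bool)).filter fun x =>
        t ≤ |((univ.filter fun i : Fin n => x i = true).card : ℝ) - n / 2|).card := by
  have hfilt : ∀ x : Fin n → Bool,
      ((univ : Finset (Fin n)).filter fun i : Fin n => (bitsToNat (List.ofFn x)).testBit i = true)
        = (univ.filter fun i : Fin n => x i = true) :=
    fun x => Finset.filter_congr fun i _ => by rw [testBit_bitsToNat_ofFn]
  refine Finset.card_nbij' (fun N : ℕ => fun j : Fin n => N.testBit j)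
    (fun x : Fin n → Bool => bitsToNat (List.ofFn x)) ?_ ?_ ?_ ?_
  · intro N hN
    have hN' := (mem_filter.mp (mem_coe.mp hN)).2
    exact mem_coe.mpr (mem_filter.mpr ⟨mem_univ _, hN'⟩)
  · intro x hx
    have hx' := (mem_filter.mp (mem_coe.mp hx)).2
    refine mem_coe.mpr (mem_filter.mpr ⟨mem_range.mpr (bitsToNat_ofFn_lt x), ?_⟩)
    rw [hfilt x]
    exact hx'
  · intro N hN
    exact bitsToNat_ofFn_testBit (mem_range.mp (mem_filter.mp (mem_coe.mp hN)).1)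
  · intro x _
    exact ofFn_testBit_bitsToNat x

/-- The exponent of the one-sided bound at threshold `2t` on `n` signs equals the registered
exponent: `(2t)²/(2n) = 2t²/n` (also for `n = 0`, where both sides are `0` in Lean). -/
theorem sliceTail_exp_eq (n : ℕ) (t : ℝ) :
    Real.exp (-((2 * t) ^ 2 / (2 * (n : ℝ)))) = Real.exp (-(2 * t ^ 2 / n)) := by
  rw [show (2 * t) ^ 2 = 2 * (2 * t ^ 2) by ring, mul_div_mul_left _ _ (two_ne_zero' ℝ)]

/-- **Stub `stub_sliceTail` (line `Sketch`, v8, K3b) — few digit strings have atypical Hamming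
weight.** For `t ≥ 0`, `#{N < 2ⁿ : t ≤ |s₂(N) − n/2|} ≤ 2 · 2ⁿ · e^{−2t²/n}`, where
`s₂(N) = #{i < n : the i-th binary digit of N is 1}`: the two-sided Hoeffding bound on the cube
(`stub_cubeTail` at threshold `2t` for the all-`true` and the all-`false` orientations, union
bound), transported to `range (2ⁿ)` by binary expansion (`sliceTail_card_transport`). -/
theorem stub_sliceTail (n : ℕ) (t : ℝ) (ht : 0 ≤ t) :
    ((((Finset.range (2 ^ n)).filter fun N =>
        t ≤ |((Finset.univ.filter fun i : Fin n => Nat.testBit N i = true).card : ℝ) - n / 2|).card : ℕ) : ℝ)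
      ≤ 2 * 2 ^ n * Real.exp (-(2 * t ^ 2 / n)) := by
  have h2t : 0 ≤ 2 * t := by positivity
  have hA := stub_cubeTail n (fun _ => true) (2 * t) h2t
  have hB := stub_cubeTail n (fun _ => false) (2 * t) h2t
  rw [sliceTail_exp_eq] at hA hB
  rw [sliceTail_card_transport]
  have hsub : ((univ : Finset (Fin n → Bool)).filter fun x =>
        t ≤ |((univ.filter fun i : Fin n => x i = true).card : ℝ) - n / 2|)
      ⊆ ((univ : Finset (Fin n → Bool)).filter fun σ =>
            2 * t ≤ ∑ j : Fin n, (if σ j = true then (1 : ℝ) else -1)) ∪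
        ((univ : Finset (Fin n → Bool)).filter fun σ =>
            2 * t ≤ ∑ j : Fin n, (if σ j = false then (1 : ℝ) else -1)) := by
    intro x hx
    have hx' := (mem_filter.mp hx).2
    rw [mem_union, mem_filter, mem_filter, sliceTail_sum_sign_true, sliceTail_sum_sign_false]
    rcases le_abs.mp hx' with h | h
    · exact Or.inl ⟨mem_univ _, by linarith⟩
    · exact Or.inr ⟨mem_univ _, by linarith⟩
  have h1 := card_le_card hsub
  have h2 := card_union_le
    ((univ : Finset (Fin n → Bool)).filter fun σ =>
        2 * t ≤ ∑ j : Fin n, (if σ j = true then (1 : ℝ) else -1))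
    ((univ : Finset (Fin n → Bool)).filter fun σ =>
        2 * t ≤ ∑ j : Fin n, (if σ j = false then (1 : ℝ) else -1))
  have h12 : ((((univ : Finset (Fin n → Bool)).filter fun x =>
        t ≤ |((univ.filter fun i : Fin n => x i = true).card : ℝ) - n / 2|).card : ℕ) : ℝ)
      ≤ ((((univ : Finset (Fin n → Bool)).filter fun σ =>
            2 * t ≤ ∑ j : Fin n, (if σ j = true then (1 : ℝ) else -1)).card : ℕ) : ℝ) +
        ((((univ : Finset (Fin n → Bool)).filter fun σ =>
            2 * t ≤ ∑ j : Fin n, (if σ j = false then (1 : ℝ) else -1)).card : ℕ) : ℝ) := by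
    exact_mod_cast h1.trans h2
  linarith [h12, hA, hB]

end Summit.QuantumAdvantage.QuantumAdvantage.Theorems.LiouvilleOrthogonalTC0

end
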